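import Mathlib
import HarnessLib
import Summits.NavierStokesRegularity.NavierStokesRegularity.Theorems.PoloidalWindowDoorLrcModEntireTwistingTHOscAncientLiouville

/-!
# Item `LrcModEntire` (stmt-NavierStokesRegularity-20428), skeleton twist_split v6, CLASS road to `stub_twistingTHGerm` —
# (K-d) the DECAY INEQUALITY of the weighted mass for the similarity-variable plane-oscillation law, and the «liminf» / «majorant» Liouville corollaries

Cell ns-regularity-ideate, seat ns-k2-port-2 g3 (ask (K-d) of the LEAD ns-poloidal-K2-p3 g13, STATUS 2026-08-29T02:00:28Z/02:09:46Z;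
`--supports stmt-NavierStokesRegularity-20428 --as helper`; sequel of `…TwistingTHOscAncientLiouville`).  Same setting: `Q ≥ 0` with
`Q_τ + ½∂_ξ((ξ+Ŝ)Q) ≤ Q_ξξ`, `|Ŝ| ≤ A`, a universal weight `w` (`w″ + ½(ξ+s)w′ ≤ −γw` for `|s| ≤ A`).  Here `Q` is NOT assumed bounded — only
polynomially bounded in `ξ` (`|Q| ≤ C(1+ξ²)^k`, uniformly in `τ`), which is what the regularity/integration steps need — and the output is the named
decay law of the weighted mass `M(τ) = ∫ Q(τ,ξ)w(ξ)dξ`: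

* `weightedMass_decay` — `M(τ₁) ≤ e^{−γ(τ₁−τ₀)}·M(τ₀)` for `τ₀ ≤ τ₁` (and `M` is finite);
* `eq_zero_of_massBound_frequently` — if `M(τ₀) ≤ B` for arbitrarily negative `τ₀` (a SEQUENCE of past times suffices), then `Q ≡ 0`;
* `eq_zero_of_majorant` — if `Q(τ,ξ) ≤ G(ξ)` for all `τ` with `G·w ∈ L¹`, then `Q ≡ 0` (bounded `Q` is the case `G ≡ c`; Gaussian growth
  `G = Ce^{κ′ξ²}`, `κ′ < κ`, is allowed against a Gaussian weight).
These are the (h1-seq) / growth relaxations of the wall (h1) recorded in the LEAD's memo OSC-LIOUVILLE-g13 v1.3 §5quinquies.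

WHAT THIS IS NOT: not a claim about Navier–Stokes regularity and not the stub (bears_on LADDER-NS N0, item 20428 / crux 19708).
-/

noncomputable section

-- the summit and its single sub-problem share the name (CONVENTIONS §1), as in every Theorems file
set_option linter.dupNamespace false

namespace Summit.NavierStokesRegularity.NavierStokesRegularity.Theorems.PoloidalWindowDoorLrcModEntireTwistingTHOscAncientLiouvilleDecay

open MeasureTheory Set Filter Topology

open Summit.NavierStokesRegularity.NavierStokesRegularity.Theorems.PoloidalWindowDoorLrcModEntireTwistingTHOscAncientLiouville

/-! ### The decay inequality -/

/-- **THE DECAY INEQUALITY OF THE WEIGHTED MASS.**  For a polynomially bounded non-negative subsolution and a universal weight (module docstring):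
`M(τ) := ∫ Q(τ,ξ)w(ξ)dξ` is finite and `M(τ₁) ≤ e^{−γ(τ₁−τ₀)}·M(τ₀)` whenever `τ₀ ≤ τ₁` (any real `γ`; `γ > 0` is decay). -/
theorem weightedMass_decay {Q Qt S : ℝ → ℝ → ℝ} {w : ℝ → ℝ} {A γ C : ℝ} {k : ℕ}
    -- the weight (analytic debt (K-a): the even principal Neumann eigenfunction of `w″ + ½(ξ−A)w′` has these properties)
    (hw : ContDiff ℝ 2 w) (hwpos : ∀ ξ, 0 < w ξ)
    (hLw : ∀ ξ s : ℝ, |s| ≤ A → deriv (deriv w) ξ + (1 / 2 : ℝ) * (ξ + s) * deriv w ξ ≤ -γ * w ξ)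
    (hWint : Integrable fun ξ => (1 + ξ ^ 2) ^ (2 * k + 1) * (|w ξ| + |deriv w ξ| + |deriv (deriv w) ξ|))
    -- the subsolution (polynomially bounded, not necessarily bounded)
    (hQ2 : ∀ τ, ContDiff ℝ 2 (Q τ)) (hQt : ∀ τ ξ, HasDerivAt (fun τ' => Q τ' ξ) (Qt τ ξ) τ) (hQtc : ∀ τ, Continuous (Qt τ))
    (h0 : ∀ τ ξ, 0 ≤ Q τ ξ) (hQb : ∀ τ ξ, |Q τ ξ| ≤ C * (1 + ξ ^ 2) ^ k)
    (hQtb : ∀ τ ξ, |Qt τ ξ| ≤ C * (1 + ξ ^ 2) ^ k) (hQ1b : ∀ τ ξ, |deriv (Q τ) ξ| ≤ C * (1 + ξ ^ 2) ^ k)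
    (hQ2b : ∀ τ ξ, |deriv (deriv (Q τ)) ξ| ≤ C * (1 + ξ ^ 2) ^ k)
    (hS : ∀ τ, ContDiff ℝ 1 (S τ)) (hSA : ∀ τ ξ, |S τ ξ| ≤ A) (hS1b : ∀ τ ξ, |deriv (S τ) ξ| ≤ C * (1 + ξ ^ 2) ^ k)
    (hsub : ∀ τ ξ, Qt τ ξ + (1 / 2 : ℝ) * deriv (fun ξ => (ξ + S τ ξ) * Q τ ξ) ξ ≤ deriv (deriv (Q τ)) ξ) :
    (∀ τ, Integrable fun ξ => Q τ ξ * w ξ) ∧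
    ∀ τ₀ τ₁, τ₀ ≤ τ₁ → ∫ ξ, Q τ₁ ξ * w ξ ≤ Real.exp (-(γ * (τ₁ - τ₀))) * ∫ ξ, Q τ₀ ξ * w ξ := by
  have hC0 : 0 ≤ C := by
    have := (abs_nonneg _).trans (hQtb 0 0)
    have hP : 0 < (1 + (0 : ℝ) ^ 2) ^ k := by positivity
    nlinarith
  have hA0 : 0 ≤ A := (abs_nonneg _).trans (hSA 0 0)
  set G : ℝ → ℝ := fun ξ => (1 + ξ ^ 2) ^ (2 * k + 1) * (|w ξ| + |deriv w ξ| + |deriv (deriv w) ξ|) with hG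
  have hP1 : ∀ ξ : ℝ, 1 ≤ (1 + ξ ^ 2) ^ k := fun ξ => one_le_pow₀ (by nlinarith [sq_nonneg ξ])
  have hPk : ∀ ξ : ℝ, (1 + ξ ^ 2) ^ k ≤ (1 + ξ ^ 2) ^ (2 * k + 1) := fun ξ =>
    pow_le_pow_right₀ (by nlinarith [sq_nonneg ξ]) (by omega)
  have hPk1 : ∀ ξ : ℝ, (1 + ξ ^ 2) ^ (k + 1) ≤ (1 + ξ ^ 2) ^ (2 * k + 1) := fun ξ =>
    pow_le_pow_right₀ (by nlinarith [sq_nonneg ξ]) (by omega)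
  have hPkk : ∀ ξ : ℝ, (1 + ξ ^ 2) ^ k * (1 + ξ ^ 2) ^ k ≤ (1 + ξ ^ 2) ^ (2 * k + 1) := fun ξ => by
    rw [← pow_add]; exact pow_le_pow_right₀ (by nlinarith [sq_nonneg ξ]) (by omega)
  have hPk' : ∀ ξ : ℝ, (1 + |ξ|) * (1 + ξ ^ 2) ^ k ≤ 2 * (1 + ξ ^ 2) ^ (2 * k + 1) := fun ξ => by
    have h1 := one_add_abs_le ξ
    have h2 : 0 ≤ (1 + ξ ^ 2) ^ k := by positivity
    calc (1 + |ξ|) * (1 + ξ ^ 2) ^ k ≤ (2 * (1 + ξ ^ 2)) * (1 + ξ ^ 2) ^ k := mul_le_mul_of_nonneg_right h1 h2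
      _ = 2 * (1 + ξ ^ 2) ^ (k + 1) := by ring
      _ ≤ 2 * (1 + ξ ^ 2) ^ (2 * k + 1) := by linarith [hPk1 ξ]
  have hP1' : ∀ ξ : ℝ, 1 ≤ (1 + ξ ^ 2) ^ (2 * k + 1) := fun ξ => one_le_pow₀ (by nlinarith [sq_nonneg ξ])
  have hwd : Differentiable ℝ w := hw.differentiable (by norm_num)
  have hw1 : ContDiff ℝ 1 (deriv w) := by
    have h2 : ContDiff ℝ (1 + 1) w := by rwa [one_add_one_eq_two]
    exact h2.deriv'
  have hw'd : Differentiable ℝ (deriv w) := hw1.differentiable (by norm_num)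
  have hwc : Continuous w := hwd.continuous
  have hw'c : Continuous (deriv w) := hw'd.continuous
  have hw''c : Continuous (deriv (deriv w)) := hw1.continuous_deriv le_rfl
  have hGw : ∀ ξ, (1 + ξ ^ 2) ^ (2 * k + 1) * |w ξ| ≤ G ξ := fun ξ => by
    simp only [hG]; nlinarith [abs_nonneg (deriv w ξ), abs_nonneg (deriv (deriv w) ξ), hP1' ξ]
  have hGw' : ∀ ξ, (1 + ξ ^ 2) ^ (2 * k + 1) * |deriv w ξ| ≤ G ξ := fun ξ => by
    simp only [hG]; nlinarith [abs_nonneg (w ξ), abs_nonneg (deriv (deriv w) ξ), hP1' ξ]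
  have hGw'' : ∀ ξ, (1 + ξ ^ 2) ^ (2 * k + 1) * |deriv (deriv w) ξ| ≤ G ξ := fun ξ => by
    simp only [hG]; nlinarith [abs_nonneg (w ξ), abs_nonneg (deriv w ξ), hP1' ξ]
  -- ## Step 1: for each `τ`, the weighted-mass inequality `∫ Qt·w ≤ −γ ∫ Q·w`
  have hstep : ∀ τ, Integrable (fun ξ => Q τ ξ * w ξ) ∧ Integrable (fun ξ => Qt τ ξ * w ξ) ∧
      ∫ ξ, Qt τ ξ * w ξ ≤ -γ * ∫ ξ, Q τ ξ * w ξ := by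
    intro τ
    have hq2 := hQ2 τ
    have hqd : Differentiable ℝ (Q τ) := hq2.differentiable (by norm_num)
    have hq1 : ContDiff ℝ 1 (deriv (Q τ)) := by
      have h2 : ContDiff ℝ (1 + 1) (Q τ) := by rw [one_add_one_eq_two]; exact hq2
      exact h2.deriv'
    have hq'd : Differentiable ℝ (deriv (Q τ)) := hq1.differentiable (by norm_num)
    have hqc : Continuous (Q τ) := hqd.continuous
    have hq'c : Continuous (deriv (Q τ)) := hq'd.continuous
    have hq''c : Continuous (deriv (deriv (Q τ))) := hq1.continuous_deriv le_rfl
    have hsd : Differentiable ℝ (S τ) := (hS τ).differentiable (by norm_num)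
    have hsc : Continuous (S τ) := hsd.continuous
    have hs'c : Continuous (deriv (S τ)) := (hS τ).continuous_deriv le_rfl
    set V : ℝ → ℝ := fun ξ => (ξ + S τ ξ) * Q τ ξ with hV
    have hVd : ∀ ξ, HasDerivAt V ((1 + deriv (S τ) ξ) * Q τ ξ + (ξ + S τ ξ) * deriv (Q τ) ξ) ξ := by
      intro ξ
      have h1 : HasDerivAt (fun ξ => ξ + S τ ξ) (1 + deriv (S τ) ξ) ξ := (hasDerivAt_id ξ).add (hsd ξ).hasDerivAt
      exact h1.mul (hqd ξ).hasDerivAt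
    have hV' : deriv V = fun ξ => (1 + deriv (S τ) ξ) * Q τ ξ + (ξ + S τ ξ) * deriv (Q τ) ξ := funext fun ξ => (hVd ξ).deriv
    have hVc : Continuous V := by rw [hV]; exact (continuous_id.add hsc).mul hqc
    have hV'c : Continuous (deriv V) := by
      rw [hV']; exact ((continuous_const.add hs'c).mul hqc).add ((continuous_id.add hsc).mul hq'c)
    have bQ : ∀ ξ, |Q τ ξ| ≤ C * (1 + ξ ^ 2) ^ k := hQb τ
    have bV : ∀ ξ, |V ξ| ≤ 2 * C * (1 + A) * (1 + ξ ^ 2) ^ (2 * k + 1) := by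
      intro ξ
      have h1 : |ξ + S τ ξ| ≤ |ξ| + A := (abs_add_le _ _).trans (by linarith [hSA τ ξ])
      have h3 : |ξ| + A ≤ (1 + A) * (1 + |ξ|) := by nlinarith [abs_nonneg ξ, mul_nonneg hA0 (abs_nonneg ξ)]
      rw [hV]
      show |(ξ + S τ ξ) * Q τ ξ| ≤ _
      rw [abs_mul]
      calc |ξ + S τ ξ| * |Q τ ξ| ≤ ((1 + A) * (1 + |ξ|)) * (C * (1 + ξ ^ 2) ^ k) :=
            mul_le_mul (h1.trans h3) (bQ ξ) (abs_nonneg _) (by positivity)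
        _ = (1 + A) * C * ((1 + |ξ|) * (1 + ξ ^ 2) ^ k) := by ring
        _ ≤ (1 + A) * C * (2 * (1 + ξ ^ 2) ^ (2 * k + 1)) := mul_le_mul_of_nonneg_left (hPk' ξ) (by positivity)
        _ = 2 * C * (1 + A) * (1 + ξ ^ 2) ^ (2 * k + 1) := by ring
    have bV' : ∀ ξ, |deriv V ξ| ≤ (C + C ^ 2 + 2 * C * (1 + A)) * (1 + ξ ^ 2) ^ (2 * k + 1) := by
      intro ξ
      rw [hV']
      set P := (1 + ξ ^ 2) ^ k with hP
      set P₂ := (1 + ξ ^ 2) ^ (2 * k + 1) with hP₂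
      have hP0 : 0 ≤ P := by positivity
      have h1 : |(1 + deriv (S τ) ξ) * Q τ ξ| ≤ (1 + C * P) * (C * P) := by
        rw [abs_mul]
        exact mul_le_mul ((abs_add_le _ _).trans (by rw [abs_one]; linarith [hS1b τ ξ])) (bQ ξ) (abs_nonneg _)
          (by nlinarith [hP1 ξ])
      have h2 : |(ξ + S τ ξ) * deriv (Q τ) ξ| ≤ (|ξ| + A) * (C * P) := by
        rw [abs_mul]
        exact mul_le_mul ((abs_add_le _ _).trans (by linarith [hSA τ ξ])) (hQ1b τ ξ) (abs_nonneg _)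
          (by linarith [abs_nonneg ξ])
      have h3 := hPk ξ
      have h4 := hPk' ξ
      have h5 := hPkk ξ
      have h1' : (1 + C * P) * (C * P) ≤ (C + C ^ 2) * P₂ := by
        have e : (1 + C * P) * (C * P) = C * P + C ^ 2 * (P * P) := by ring
        rw [e]; nlinarith [mul_nonneg hC0 (sub_nonneg.2 h3), mul_nonneg (sq_nonneg C) (sub_nonneg.2 h5)]
      have h2' : (|ξ| + A) * (C * P) ≤ 2 * C * (1 + A) * P₂ := by
        have h6 : |ξ| + A ≤ (1 + A) * (1 + |ξ|) := by nlinarith [abs_nonneg ξ, mul_nonneg hA0 (abs_nonneg ξ)]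
        calc (|ξ| + A) * (C * P) ≤ ((1 + A) * (1 + |ξ|)) * (C * P) := mul_le_mul_of_nonneg_right h6 (by positivity)
          _ = (1 + A) * C * ((1 + |ξ|) * P) := by ring
          _ ≤ (1 + A) * C * (2 * P₂) := mul_le_mul_of_nonneg_left h4 (by positivity)
          _ = 2 * C * (1 + A) * P₂ := by ring
      calc |(1 + deriv (S τ) ξ) * Q τ ξ + (ξ + S τ ξ) * deriv (Q τ) ξ|
          ≤ (1 + C * P) * (C * P) + (|ξ| + A) * (C * P) := (abs_add_le _ _).trans (add_le_add h1 h2)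
        _ ≤ (C + C ^ 2) * P₂ + 2 * C * (1 + A) * P₂ := add_le_add h1' h2'
        _ = (C + C ^ 2 + 2 * C * (1 + A)) * P₂ := by ring
    have iQw : Integrable fun ξ => Q τ ξ * w ξ := integrable_of_abs_le (hqc.mul hwc) hWint C fun ξ =>
      abs_mul_le_of_bounds hC0 (bQ ξ) (hPk ξ) (hGw ξ)
    have iQtw : Integrable fun ξ => Qt τ ξ * w ξ := integrable_of_abs_le ((hQtc τ).mul hwc) hWint C fun ξ =>
      abs_mul_le_of_bounds hC0 (hQtb τ ξ) (hPk ξ) (hGw ξ)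
    have iQ''w : Integrable fun ξ => w ξ * deriv (deriv (Q τ)) ξ := integrable_of_abs_le (hwc.mul hq''c) hWint C fun ξ =>
      abs_mul_le_of_bounds' hC0 (hQ2b τ ξ) (hPk ξ) (hGw ξ)
    have iQ'w' : Integrable fun ξ => deriv w ξ * deriv (Q τ) ξ := integrable_of_abs_le (hw'c.mul hq'c) hWint C fun ξ =>
      abs_mul_le_of_bounds' hC0 (hQ1b τ ξ) (hPk ξ) (hGw' ξ)
    have iQ'w : Integrable fun ξ => w ξ * deriv (Q τ) ξ := integrable_of_abs_le (hwc.mul hq'c) hWint C fun ξ =>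
      abs_mul_le_of_bounds' hC0 (hQ1b τ ξ) (hPk ξ) (hGw ξ)
    have iQw'' : Integrable fun ξ => deriv (deriv w) ξ * Q τ ξ := integrable_of_abs_le (hw''c.mul hqc) hWint C fun ξ =>
      abs_mul_le_of_bounds' hC0 (bQ ξ) (hPk ξ) (hGw'' ξ)
    have iQw' : Integrable fun ξ => deriv w ξ * Q τ ξ := integrable_of_abs_le (hw'c.mul hqc) hWint C fun ξ =>
      abs_mul_le_of_bounds' hC0 (bQ ξ) (hPk ξ) (hGw' ξ)
    have hK1 : 0 ≤ C + C ^ 2 + 2 * C * (1 + A) := by positivity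
    have hK2 : 0 ≤ 2 * C * (1 + A) := by positivity
    have iwV' : Integrable fun ξ => w ξ * deriv V ξ :=
      integrable_of_abs_le (hwc.mul hV'c) hWint (C + C ^ 2 + 2 * C * (1 + A)) fun ξ =>
        abs_mul_le_of_bounds' hK1 (bV' ξ) le_rfl (hGw ξ)
    have iw'V : Integrable fun ξ => deriv w ξ * V ξ :=
      integrable_of_abs_le (hw'c.mul hVc) hWint (2 * C * (1 + A)) fun ξ =>
        abs_mul_le_of_bounds' hK2 (bV ξ) le_rfl (hGw' ξ)
    have iwV : Integrable fun ξ => w ξ * V ξ :=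
      integrable_of_abs_le (hwc.mul hVc) hWint (2 * C * (1 + A)) fun ξ =>
        abs_mul_le_of_bounds' hK2 (bV ξ) le_rfl (hGw ξ)
    have ibp1 : ∫ ξ, w ξ * deriv (deriv (Q τ)) ξ = -∫ ξ, deriv w ξ * deriv (Q τ) ξ :=
      integral_mul_deriv_eq_deriv_mul_of_integrable (u := w) (v := deriv (Q τ)) (u' := deriv w) (v' := deriv (deriv (Q τ)))
        (fun ξ _ => (hwd ξ).hasDerivAt) (fun ξ _ => (hq'd ξ).hasDerivAt) iQ''w iQ'w' iQ'w
    have ibp2 : ∫ ξ, deriv w ξ * deriv (Q τ) ξ = -∫ ξ, deriv (deriv w) ξ * Q τ ξ :=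
      integral_mul_deriv_eq_deriv_mul_of_integrable (u := deriv w) (v := Q τ) (u' := deriv (deriv w)) (v' := deriv (Q τ))
        (fun ξ _ => (hw'd ξ).hasDerivAt) (fun ξ _ => (hqd ξ).hasDerivAt) iQ'w' iQw'' iQw'
    have ibp3 : ∫ ξ, w ξ * deriv V ξ = -∫ ξ, deriv w ξ * V ξ :=
      integral_mul_deriv_eq_deriv_mul_of_integrable (u := w) (v := V) (u' := deriv w) (v' := deriv V)
        (fun ξ _ => (hwd ξ).hasDerivAt) (fun ξ _ => (hVd ξ).differentiableAt.hasDerivAt) iwV' iw'V iwV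
    have hderivV : ∀ ξ, deriv (fun ξ => (ξ + S τ ξ) * Q τ ξ) ξ = deriv V ξ := fun ξ => by rw [hV]
    have hpt : ∀ ξ, Qt τ ξ * w ξ ≤ w ξ * deriv (deriv (Q τ)) ξ - (1 / 2 : ℝ) * (w ξ * deriv V ξ) := by
      intro ξ
      have h := hsub τ ξ
      rw [hderivV ξ] at h
      have hw0 := (hwpos ξ).le
      nlinarith [mul_le_mul_of_nonneg_right h hw0]
    have hI1 : ∫ ξ, Qt τ ξ * w ξ ≤ ∫ ξ, (w ξ * deriv (deriv (Q τ)) ξ - (1 / 2 : ℝ) * (w ξ * deriv V ξ)) :=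
      integral_mono iQtw (iQ''w.sub (iwV'.const_mul _)) hpt
    have hI2 : ∫ ξ, (w ξ * deriv (deriv (Q τ)) ξ - (1 / 2 : ℝ) * (w ξ * deriv V ξ)) =
        ∫ ξ, (deriv (deriv w) ξ * Q τ ξ + (1 / 2 : ℝ) * (deriv w ξ * V ξ)) := by
      rw [integral_sub iQ''w (iwV'.const_mul _), integral_const_mul, ibp1, ibp2, ibp3,
        integral_add iQw'' (iw'V.const_mul _), integral_const_mul]
      ring
    have hpt2 : ∀ ξ, deriv (deriv w) ξ * Q τ ξ + (1 / 2 : ℝ) * (deriv w ξ * V ξ) ≤ -γ * (Q τ ξ * w ξ) := by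
      intro ξ
      have h := hLw ξ (S τ ξ) (hSA τ ξ)
      have hq0 := h0 τ ξ
      have e : deriv (deriv w) ξ * Q τ ξ + (1 / 2 : ℝ) * (deriv w ξ * V ξ) =
          (deriv (deriv w) ξ + (1 / 2 : ℝ) * (ξ + S τ ξ) * deriv w ξ) * Q τ ξ := by rw [hV]; ring
      rw [e]
      nlinarith [mul_le_mul_of_nonneg_right h hq0]
    have hI3 : ∫ ξ, (deriv (deriv w) ξ * Q τ ξ + (1 / 2 : ℝ) * (deriv w ξ * V ξ)) ≤ ∫ ξ, -γ * (Q τ ξ * w ξ) :=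
      integral_mono (iQw''.add (iw'V.const_mul _)) (iQw.const_mul _) hpt2
    refine ⟨iQw, iQtw, ?_⟩
    calc ∫ ξ, Qt τ ξ * w ξ ≤ _ := hI1
      _ = _ := hI2
      _ ≤ ∫ ξ, -γ * (Q τ ξ * w ξ) := hI3
      _ = -γ * ∫ ξ, Q τ ξ * w ξ := integral_const_mul _ _
  -- ## Step 2: `I(τ) = ∫ Q w` is differentiable with `I′ = ∫ Qt w`
  set I : ℝ → ℝ := fun τ => ∫ ξ, Q τ ξ * w ξ with hI
  have hIderiv : ∀ τ, HasDerivAt I (∫ ξ, Qt τ ξ * w ξ) τ := by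
    intro τ₀
    have h := hasDerivAt_integral_of_dominated_loc_of_deriv_le (μ := volume) (F := fun τ ξ => Q τ ξ * w ξ)
      (F' := fun τ ξ => Qt τ ξ * w ξ) (x₀ := τ₀) (s := univ) (bound := fun ξ => C * (1 + ξ ^ 2) ^ k * |w ξ|) univ_mem
      (Eventually.of_forall fun τ => (hstep τ).1.aestronglyMeasurable) (hstep τ₀).1 (hstep τ₀).2.1.aestronglyMeasurable
      (Eventually.of_forall fun ξ τ _ => by
        rw [Real.norm_eq_abs, abs_mul]
        exact mul_le_mul_of_nonneg_right (hQtb τ ξ) (abs_nonneg _))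
      (integrable_of_abs_le ((continuous_const.mul ((continuous_const.add (continuous_pow 2)).pow k)).mul hwc.abs) hWint C
        fun ξ => by
          have hb : |C * (1 + ξ ^ 2) ^ k| ≤ C * (1 + ξ ^ 2) ^ k := by
            rw [abs_of_nonneg (by positivity)]
          have hg' : (1 + ξ ^ 2) ^ (2 * k + 1) * |(|w ξ|)| ≤ G ξ := by rw [abs_abs]; exact hGw ξ
          have h := abs_mul_le_of_bounds (G := G ξ) hC0 hb (hPk ξ) hg'
          simpa [mul_assoc] using h)
      (Eventually.of_forall fun ξ τ _ => (hQt τ ξ).mul_const (w ξ))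
    exact h.2
  -- ## Step 3: `e^{γτ} I(τ)` is non-increasing, hence `I(τ) ≤ e^{−γ(τ−τ₀)} I(τ₀) ≤ e^{−γ(τ−τ₀)} c ‖w‖₁`
  have hInonneg : ∀ τ, 0 ≤ I τ := fun τ => integral_nonneg fun ξ => mul_nonneg (h0 τ ξ) (hwpos ξ).le
  set J : ℝ → ℝ := fun τ => Real.exp (γ * τ) * I τ with hJ
  have hJd : ∀ τ, HasDerivAt J (Real.exp (γ * τ) * (γ * I τ + ∫ ξ, Qt τ ξ * w ξ)) τ := by
    intro τ
    have he : HasDerivAt (fun τ => Real.exp (γ * τ)) (Real.exp (γ * τ) * γ) τ := by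
      have h := ((hasDerivAt_id τ).const_mul γ).exp
      simpa using h
    exact (he.mul (hIderiv τ)).congr_deriv (by ring)
  have hJanti : Antitone J := by
    refine antitone_of_deriv_nonpos (fun τ => (hJd τ).differentiableAt) fun τ => ?_
    rw [(hJd τ).deriv]
    have h := (hstep τ).2.2
    have : γ * I τ + ∫ ξ, Qt τ ξ * w ξ ≤ 0 := by simp only [hI] at h ⊢; linarith
    exact mul_nonpos_of_nonneg_of_nonpos (Real.exp_pos _).le this
  refine ⟨fun τ => (hstep τ).1, fun τ₀ τ hle => ?_⟩
  have hJ' : J τ ≤ J τ₀ := hJanti hle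
  simp only [hJ] at hJ'
  have he : Real.exp (γ * τ) = Real.exp (γ * τ₀) * Real.exp (γ * (τ - τ₀)) := by
    rw [← Real.exp_add]; ring_nf
  have hpos := Real.exp_pos (γ * (τ - τ₀))
  have hpos0 := Real.exp_pos (γ * τ₀)
  have h2 : Real.exp (γ * (τ - τ₀)) * I τ ≤ I τ₀ := by
    have h3 : Real.exp (γ * τ₀) * (Real.exp (γ * (τ - τ₀)) * I τ) ≤ Real.exp (γ * τ₀) * I τ₀ := by
      rw [← mul_assoc, ← he]; exact hJ'
    exact le_of_mul_le_mul_left h3 hpos0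
  show I τ ≤ Real.exp (-(γ * (τ - τ₀))) * I τ₀
  rw [Real.exp_neg]
  have e3 : I τ = (Real.exp (γ * (τ - τ₀)))⁻¹ * (Real.exp (γ * (τ - τ₀)) * I τ) := by
    field_simp
  rw [e3]; exact mul_le_mul_of_nonneg_left h2 (inv_nonneg.2 hpos.le)

/-! ### Liouville corollaries: a bounded weighted mass along SOME past sequence, or a fixed integrable majorant -/

/-- **Liouville from a weighted-mass bound at arbitrarily negative times** ((h1-seq)): under the hypotheses of `weightedMass_decay`, if
`∫ Q(τ₀,ξ)w(ξ)dξ ≤ B` for some `τ₀ ≤ T`, for EVERY `T`, then `Q ≡ 0`. -/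
theorem eq_zero_of_massBound_frequently {Q Qt S : ℝ → ℝ → ℝ} {w : ℝ → ℝ} {A γ C B : ℝ} {k : ℕ}
    (hw : ContDiff ℝ 2 w) (hwpos : ∀ ξ, 0 < w ξ) (hγ : 0 < γ)
    (hLw : ∀ ξ s : ℝ, |s| ≤ A → deriv (deriv w) ξ + (1 / 2 : ℝ) * (ξ + s) * deriv w ξ ≤ -γ * w ξ)
    (hWint : Integrable fun ξ => (1 + ξ ^ 2) ^ (2 * k + 1) * (|w ξ| + |deriv w ξ| + |deriv (deriv w) ξ|))
    (hQ2 : ∀ τ, ContDiff ℝ 2 (Q τ)) (hQt : ∀ τ ξ, HasDerivAt (fun τ' => Q τ' ξ) (Qt τ ξ) τ) (hQtc : ∀ τ, Continuous (Qt τ))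
    (h0 : ∀ τ ξ, 0 ≤ Q τ ξ) (hQb : ∀ τ ξ, |Q τ ξ| ≤ C * (1 + ξ ^ 2) ^ k)
    (hQtb : ∀ τ ξ, |Qt τ ξ| ≤ C * (1 + ξ ^ 2) ^ k) (hQ1b : ∀ τ ξ, |deriv (Q τ) ξ| ≤ C * (1 + ξ ^ 2) ^ k)
    (hQ2b : ∀ τ ξ, |deriv (deriv (Q τ)) ξ| ≤ C * (1 + ξ ^ 2) ^ k)
    (hS : ∀ τ, ContDiff ℝ 1 (S τ)) (hSA : ∀ τ ξ, |S τ ξ| ≤ A) (hS1b : ∀ τ ξ, |deriv (S τ) ξ| ≤ C * (1 + ξ ^ 2) ^ k)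
    (hsub : ∀ τ ξ, Qt τ ξ + (1 / 2 : ℝ) * deriv (fun ξ => (ξ + S τ ξ) * Q τ ξ) ξ ≤ deriv (deriv (Q τ)) ξ)
    (hB : ∀ T : ℝ, ∃ τ₀, τ₀ ≤ T ∧ ∫ ξ, Q τ₀ ξ * w ξ ≤ B) :
    ∀ τ ξ, Q τ ξ = 0 := by
  obtain ⟨hint, hdecay⟩ := weightedMass_decay hw hwpos hLw hWint hQ2 hQt hQtc h0 hQb hQtb hQ1b hQ2b hS hSA hS1b hsub
  have hInonneg : ∀ τ, 0 ≤ ∫ ξ, Q τ ξ * w ξ := fun τ => integral_nonneg fun ξ => mul_nonneg (h0 τ ξ) (hwpos ξ).le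
  have hB0 : 0 ≤ B := by obtain ⟨τ₀, -, h⟩ := hB 0; exact (hInonneg τ₀).trans h
  -- `I(τ) ≤ e^{−γ(τ−T)}·B` for every `T ≤ τ`
  have hIT : ∀ τ T, T ≤ τ → ∫ ξ, Q τ ξ * w ξ ≤ Real.exp (-(γ * (τ - T))) * B := by
    intro τ T hT
    obtain ⟨τ₀, hτ₀, hτ₀B⟩ := hB T
    have h1 := hdecay τ₀ τ (hτ₀.trans hT)
    have h2 : Real.exp (-(γ * (τ - τ₀))) ≤ Real.exp (-(γ * (τ - T))) := Real.exp_le_exp.2 (by nlinarith)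
    calc ∫ ξ, Q τ ξ * w ξ ≤ Real.exp (-(γ * (τ - τ₀))) * ∫ ξ, Q τ₀ ξ * w ξ := h1
      _ ≤ Real.exp (-(γ * (τ - τ₀))) * B := mul_le_mul_of_nonneg_left hτ₀B (Real.exp_pos _).le
      _ ≤ Real.exp (-(γ * (τ - T))) * B := mul_le_mul_of_nonneg_right h2 hB0
  have hIzero : ∀ τ, ∫ ξ, Q τ ξ * w ξ = 0 := by
    intro τ
    have hlim : Tendsto (fun T : ℝ => Real.exp (-(γ * (τ - T))) * B) atBot (𝓝 0) := by
      have h1 : Tendsto (fun T : ℝ => -(γ * (τ - T))) atBot atBot := by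
        have e : (fun T : ℝ => -(γ * (τ - T))) = fun T => γ * T + -(γ * τ) := by funext T; ring
        rw [e]
        exact tendsto_atBot_add_const_right _ _ (tendsto_id.const_mul_atBot hγ)
      have h2 := Real.tendsto_exp_atBot.comp h1
      simpa using h2.mul_const B
    have hle : ∫ ξ, Q τ ξ * w ξ ≤ 0 := ge_of_tendsto hlim (eventually_atBot.2 ⟨τ, fun T h => hIT τ T h⟩)
    exact le_antisymm hle (hInonneg τ)
  intro τ ξ
  have hf0 : (fun ξ => Q τ ξ * w ξ) =ᵐ[volume] 0 :=
    (integral_eq_zero_iff_of_nonneg (fun ξ => mul_nonneg (h0 τ ξ) (hwpos ξ).le) (hint τ)).1 (hIzero τ)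
  have hcont : Continuous fun ξ => Q τ ξ * w ξ := ((hQ2 τ).continuous.mul hw.continuous)
  have hzero : (fun ξ => Q τ ξ * w ξ) = 0 := (hcont.ae_eq_iff_eq volume continuous_const).1 hf0
  have := congrFun hzero ξ
  simp only [Pi.zero_apply, mul_eq_zero] at this
  exact this.resolve_right (hwpos ξ).ne'

/-- **Liouville under a fixed integrable majorant**: if `Q(τ,ξ) ≤ G(ξ)` for all `τ` with `G·w ∈ L¹`, then `Q ≡ 0` (bounded `Q` is `G ≡ c`;
Gaussian growth `Ce^{κ′ξ²}` with `κ′ < κ` is admissible against a weight with Gaussian decay `e^{−κξ²}`). -/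
theorem eq_zero_of_majorant {Q Qt S : ℝ → ℝ → ℝ} {w G : ℝ → ℝ} {A γ C : ℝ} {k : ℕ}
    (hw : ContDiff ℝ 2 w) (hwpos : ∀ ξ, 0 < w ξ) (hγ : 0 < γ)
    (hLw : ∀ ξ s : ℝ, |s| ≤ A → deriv (deriv w) ξ + (1 / 2 : ℝ) * (ξ + s) * deriv w ξ ≤ -γ * w ξ)
    (hWint : Integrable fun ξ => (1 + ξ ^ 2) ^ (2 * k + 1) * (|w ξ| + |deriv w ξ| + |deriv (deriv w) ξ|))
    (hQ2 : ∀ τ, ContDiff ℝ 2 (Q τ)) (hQt : ∀ τ ξ, HasDerivAt (fun τ' => Q τ' ξ) (Qt τ ξ) τ) (hQtc : ∀ τ, Continuous (Qt τ))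
    (h0 : ∀ τ ξ, 0 ≤ Q τ ξ) (hQb : ∀ τ ξ, |Q τ ξ| ≤ C * (1 + ξ ^ 2) ^ k)
    (hQtb : ∀ τ ξ, |Qt τ ξ| ≤ C * (1 + ξ ^ 2) ^ k) (hQ1b : ∀ τ ξ, |deriv (Q τ) ξ| ≤ C * (1 + ξ ^ 2) ^ k)
    (hQ2b : ∀ τ ξ, |deriv (deriv (Q τ)) ξ| ≤ C * (1 + ξ ^ 2) ^ k)
    (hS : ∀ τ, ContDiff ℝ 1 (S τ)) (hSA : ∀ τ ξ, |S τ ξ| ≤ A) (hS1b : ∀ τ ξ, |deriv (S τ) ξ| ≤ C * (1 + ξ ^ 2) ^ k)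
    (hsub : ∀ τ ξ, Qt τ ξ + (1 / 2 : ℝ) * deriv (fun ξ => (ξ + S τ ξ) * Q τ ξ) ξ ≤ deriv (deriv (Q τ)) ξ)
    (hG : ∀ τ ξ, Q τ ξ ≤ G ξ) (hGw : Integrable fun ξ => G ξ * w ξ) :
    ∀ τ ξ, Q τ ξ = 0 := by
  have hint := (weightedMass_decay hw hwpos hLw hWint hQ2 hQt hQtc h0 hQb hQtb hQ1b hQ2b hS hSA hS1b hsub).1
  refine eq_zero_of_massBound_frequently hw hwpos hγ hLw hWint hQ2 hQt hQtc h0 hQb hQtb hQ1b hQ2b hS hSA hS1b hsub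
    (B := ∫ ξ, G ξ * w ξ) fun T => ⟨T, le_rfl, ?_⟩
  exact integral_mono (hint T) hGw fun ξ => mul_le_mul_of_nonneg_right (hG T ξ) (hwpos ξ).le

end Summit.NavierStokesRegularity.NavierStokesRegularity.Theorems.PoloidalWindowDoorLrcModEntireTwistingTHOscAncientLiouvilleDecay
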